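import Literature.MathematicalPhysics.QuantumFieldTheory.Balaban1983to89.B9Thm34HolderLeftFinal

/-!
# `Balaban1983to89.B9Thm34HolderRightG` — B9 Theorem 3.4 × Theorem 3.3 × (3.43): the Hölder member WITH THE DERIVATIVE ON THE RIGHT
# («‖ζG∇*_U J‖_β») for the perturbed `G(U′U)` of (3.84)–(3.86), at the device level of `B9Ineq386CommSum` / `B9Ineq386V3Concrete`

statement-level skeleton of published theorems with citation tags; proofs where landed; nothing here is a claim about the Yang–Mills mass gap

CITATION HEADER (lean-in-tree rule).  T. Bałaban, *Propagators for lattice gauge theories in a background field*, Commun. Math. Phys.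
**99** (1985) 389–434 [Balaban1985BackgroundPropagators] (cell paper B9; `paper:balaban1985-cmp99-background-propagators`, journal page =
PDF page + 388): Theorem 3.4 p. 400 [PDF 12] («The extended operators satisfy all the inequalities of Theorems 3.1–3.3 correspondingly»),
Theorem 3.3 p. 399 [PDF 11] (the inequalities (3.42)–(3.46) hold for `G(U)` «with λ replaced by J»), Theorem 3.1 (3.40) p. 397 and
(3.42)–(3.43) pp. 397–398 [PDF 9–10] (the member «‖ζG′∇*_Uλ‖_β ≦ B₀(β₀)(Lʲη)^{1−β}(‖ζ‖_β^ξ + |ζ|)e^{−δ₀d(y,y′)}|λ|» of (3.43) and the remark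
«the choice of derivatives ∇_U, ∇*_U is conventional, we may always replace ∇_U by ∇*_U, and vice versa»), (3.84)–(3.86) p. 407 [PDF 19]
(«Δ_a(U′U) = Δ_a(U) − V(A) = (I − V(A)G(U))Δ_a(U)» (3.84), «G(U′U) = G(U)(I − V(A)G(U))⁻¹ = Σ_{n=0}^∞ G(U)(V(A)G(U))ⁿ» (3.86) — the one-step
resolvent form `G(U′U) = G(U) + G(U)V(A)G(U′U)` used below is OUR immediate consequence of (3.84) and the two inverse identities, not a printed
display —, «Thus Theorem 3.4 is proved, assuming that Theorems 3.1–3.3 hold»), (3.70)–(3.73) pp. 404–405, (3.77) p. 406, (3.83) p. 407; [4] = T. Bałaban, *Propagators and renormalization transformations for lattice gauge theories. II*,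
Commun. Math. Phys. **96** (1984) 223–250 [Balaban1984PropagatorsII], (2.51)–(2.55) p. 232 («A summation preserves it also», «this property
is preserved under the composition»), Lemma 2.1 p. 234.  Pages re-read by this seat (r06 gen 17) as text `p0009`–`p0012`, `p0019` of the held
paper.  Cell `lit-balaban`, seat r06 (B9 fold owner) gen 17, FILE 35; SKELETON rows **B9.Thm3.4** × B9.Thm3.3 × B9.Thm3.1 ((3.43) cell) ×
B9.Eq3.85 (cells).  Sibling of FILE 34 `B9Thm34HolderLeftFinal` (its §6 = the same member for `G′(U′U)`).  v1.1 (r06 gen 18, DOC-ONLY, declarations byte-identical):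
referee ref-4 hygiene S-B9-g54-1 — the (3.84)/(3.86) quotations of this header made print-verbatim (the one-step resolvent form moved outside the
quotation marks) and the p. 398 remark quoted with its printed punctuation.

WHY THIS FILE.  FILE 34 proved the (3.43) Hölder members with the derivative on the LEFT for the concrete `G′(U′U)` and `G(U′U)` (every left
entry transfers, FILES 26/28) and, §6, the member with the derivative on the RIGHT for `G′(U′U)`.  The remaining (3.43) member on the
`G`-side — Theorem 3.3's «‖ζG(U′U)∇*_U J‖_β» — is proved here by the same route on the `G`-side devices: (3.86) read on a right letter `D_s`,
`G(U′U)D_s = G(U)D_s + (G(U)V(A))(G(U′U)D_s)` (from `G(U)Δ_a(U) = 1`, (3.84) and `Δ_a(U′U)G(U′U) = 1`); left-multiplied by the POINT PROBE `X`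
of FILE 34 §1 (`LinearMap.single p₀ ∘ φ`: a bound on a linear functional of the output IS a [4] (2.51) block majorant of `X·(operator)`) the
first term is the input (c), the second is `(X·G(U))·V(A) ≺ κ₃₈₅(B₀′)α₁e^{−ρd}` — FILES 20/24's LEFT COMPOSITE
`B9Ineq386CommSum.hasMajorant_GV_of_gradForm_comm_sum` ((3.85) from the gradient form (3.70)–(3.73), the commutator letters, (3.77), (3.83))
APPLIED TO THE OPERATOR `X·G(U)`, whose (3.42)₁- and (3.42)₃-shaped majorants ARE the inputs (a) (the (3.40) quotient of `ζG(U)J` itself) and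
(b) («‖ζG(U)∇_kJ‖_β» for the `2d` concrete difference letters) — composed ([4] (2.52)–(2.55) + Lemma 2.1,
`B9Ineq366CPrime.hasMajorant_comp_decay_left1`) with the right entry `G(U′U)D_s ≺ A₂Lʲηe^{−ρ₂d}` of the SAME `G(U′U)`; `κ₃₈₅` is linear in the
constant it is fed (`kappa385 B₀′ … = B₀′·kappa385 1 …`, by `unfold`).
* §1 `probeRight_of_inverse` — the abstract device: any carrier `W`, letters exactly as in `hasMajorant_GV_of_gradForm_comm_sum`, `G(U)` with
  `G(U)Δ_a = 1`, `G(U′U)` ANY solution of `(Δ_a − V(A))G(U′U) = 1` possessing a right entry `G(U′U)D_s ≺ A₂Lʲηe^{−ρ₂d}`; probe data (a), (b),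
  (c) at a constant `B₀′` ⇒ `|φ(G(U′U)D_sμ)| ≦ B₀′(1 + κ₃₈₅(1)α₁A₂Cc₁(r₀,β′))Lʲη e^{−ρ₃d(y₀,y′)}|μ|` for every target rate
  `0 ≦ ρ₃ ≦ min(ρ₂, δ)` with `ρ₃ + (α′+β′)r₀ ≦ ρ` (scale transfer of `Lʲη` at `(r₀, α′, C)`, [4] (2.61) at `(r₀, β′)`).
* §2 `thm34_G_holderRight_concreteV₃` — HYPOTHESES = gen 11's `B9Ineq386V3Concrete.thm34_G_entries13_concreteV₃` VERBATIM (binder block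
  extracted from the tree by line range) + a target rate `0 ≦ ρ₃ ≦ (1 − 3α′)ρ`; CONCLUSION = its four conjuncts (two-sided inverse of
  `Δ_a(U′U)`, (3.42)₁, (3.42)₃) for ONE `G(U′U)` AND, for that `G(U′U)`, the clause `∀ Φ y p₀ γ B_h c_ζ`: (a) `‖Φ(G(U)J)‖ ≦
  B_h(Lʲη)^{2−γ}c_ζe^{−δd(y,y′)}|J|`, (b) `‖Φ(G(U)∇_kJ)‖ ≦ B_h(Lʲη)^{1−γ}c_ζe^{−δd}|J|` (`k ∈ κ ⊕ κ`), (c) the same for `G(U)D_s` ⇒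
  `‖Φ(G(U′U)D_sJ)‖ ≦ B·B_h(Lʲη)^{1−γ}c_ζe^{−ρ₃d(y,y′)}|J|`, `B = (Σ_i‖b_i‖)M₂(1 + κ₃₈₅(1)α₁·A₂·Λ_ρ·c₁(ρ,α′))`, `A₂ = B₀Λ_ρ²c₁(ρ,α′)(1 −
  κ₃₈₅′α₁c₁(ρ,α′))⁻¹` the constant of the fourth conjunct (coordinatewise §1 with `B₀′ = M₂B_h(Lʲη)^{−γ}c_ζ`, then the norm from the
  coordinates, FILE 34 §2).

HONEST SCOPE.  (a) Theorem 3.3 for `G(U)` is an INPUT per functional, as in FILE 34: input (a) is the (3.40) quotient of `ζG(U)J` itself —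
NOT a (3.43) member (in print it follows from (3.42)₂) — and (b), (c) are (3.43) members for `U`; all three are hypotheses of the clause.
(b) `Φ` is an arbitrary `ℝ`-linear `𝔸`-valued functional of the bond function `κ × S → 𝔸`: the metric `|x − x′|`, the contours, the transport
`R(U(Γ))` and the localisation `ζ ∈ C₀^∞` of (3.40) are not modelled — they decide which `Φ` and which weights `γ, B_h, c_ζ` the user feeds in
(FILE 34 §3 `holderQuot340_apply`); derivative and transport of `U` on both sides (p. 398 «conventional»).  (c) DEVICE LEVEL of gen 11: `P₁`,
`P₂`, `D_s`, the (3.76)/(3.80) expansions, the located geometry and the smallness `κ₃₈₅′α₁c₁ < 1` are abstract hypotheses exactly as in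
`thm34_G_entries13_concreteV₃`; the FINAL-level `G(U′U)` of FILE 28 `B9Thm34AllFinal.thm34_all_final` (built through FILES 16/20/24/25's
thresholds) is NOT re-threaded here — its left-derivative member is FILE 34 §5.  (d) NOT covered anywhere yet: the input-side Hölder norms
(3.44)–(3.45), the `L²` members (3.46), (3.47).

RELATED IN THE TREE, NOT DUPLICATED (searched 2026-08-22: `lean search probeRight` = ∅; `lean search holderRight` = FILE 34 §6
`thm34_Gp_holderRight_final` only; `ls Balaban1983to89 | grep -i Holder` = `B6BlockHolderCalculus` (p38; other carriers, pair-bound calculus —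
not needed: on B9's carriers the point probe + the existing composites suffice), `B9Eq340HolderZd` (r-lineage B7/B8: the (3.40) seminorms
`hquot`/`holder0`/`holder1` WITH the transport `R(U(Γ_{x,x′}))` constructed on the concrete `ℤᵈ` carriers — a source of the functionals `Φ`
for a `ℤᵈ` model; on this file's abstract carrier `S` the functional stays a parameter), `B9Thm34HolderLeftFinal`): FILE 34 §1–§2
(`hasMajorant_pointProbe_mul`, `probe_le_of_hasMajorant_pointProbe_mul`, `norm_le_sum_norm_mul_of_repr_le`, `coordProbe_apply`),
`B9Ineq386CommSum.hasMajorant_GV_of_gradForm_comm_sum`, `B9Ineq386V3Concrete.thm34_G_entries13_concreteV₃` and its `V₃`-side identifications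
(`conj_V₃Op_eq_gradForm`, `conj_V₃Op_eq_vThree`, `conj_lapDDLetter_prodCfg`, `hasMajorant_V₃_zero`, `hasMajorant_V₃_one`,
`B9Eq373CurvComm.hasMajorant_comm_V₃_one`, `norm_plaqU_adjacent_of_through`), `B9Eq386Neumann.eq384_sub`,
`B9Ineq366CPrime.hasMajorant_comp_decay_left1` / `hasMajorant_rate_mono` — all used BY NAME.
-/

noncomputable section

namespace Literature.MathematicalPhysics.QuantumFieldTheory.Balaban1983to89.B9Thm34HolderRightG

open NormedSpace Complex
open Literature.MathematicalPhysics.QuantumFieldTheory.Balaban1983to89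
open Literature.MathematicalPhysics.QuantumFieldTheory.Balaban1983to89.B6RandomWalk (HasMajorant hasMajorant_mono hasMajorant_add
  Triangle254 Ineq261)
open Literature.MathematicalPhysics.QuantumFieldTheory.Balaban1983to89.B9Thm34Ext (toB6)
open Literature.MathematicalPhysics.QuantumFieldTheory.Balaban1983to89.B9Ineq347 (ScaleTransfer)
open Literature.MathematicalPhysics.QuantumFieldTheory.Balaban1983to89.B9Eq386Neumann (vTotal vThree pTwo deltaA)
open Literature.MathematicalPhysics.QuantumFieldTheory.Balaban1983to89.B9Ineq385VG (kappa385 kappa385_nonneg)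
open Literature.MathematicalPhysics.QuantumFieldTheory.Balaban1983to89.B9Ineq386CommSum (thm34_G_entries13_opForm_of_comm_sum)
open Literature.MathematicalPhysics.QuantumFieldTheory.Balaban1983to89.B9Eq39Adjoint
open Literature.MathematicalPhysics.QuantumFieldTheory.Balaban1983to89.B9Eq369Small (Through)
open Literature.MathematicalPhysics.QuantumFieldTheory.Balaban1983to89.B9Eq372Locality (stBonds)
open Literature.MathematicalPhysics.QuantumFieldTheory.Balaban1983to89.B9Eq352DivForm (tauF tauB)
open Literature.MathematicalPhysics.QuantumFieldTheory.Balaban1983to89.B9Eq352DivFormLetters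
open Literature.MathematicalPhysics.QuantumFieldTheory.Balaban1983to89.B9Eq352GradLetters (diffLetter)
open Literature.MathematicalPhysics.QuantumFieldTheory.Balaban1983to89.B9Eq371GradLetters (bT bU zeroLetter V1Letter)
open Literature.MathematicalPhysics.QuantumFieldTheory.Balaban1983to89.B9Eq375GradLetters (zeroLetter₂ V1Letter₂)
open Literature.MathematicalPhysics.QuantumFieldTheory.Balaban1983to89.B9Eq372RemLetters
open Literature.MathematicalPhysics.QuantumFieldTheory.Balaban1983to89.B9Eq382V3Letters
open Literature.MathematicalPhysics.QuantumFieldTheory.Balaban1983to89.B9Ineq385V3Concrete (cV385 cV0_nonneg cV385_nonneg)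
open Literature.MathematicalPhysics.QuantumFieldTheory.Balaban1983to89.B12Eq313JSlot (norm_plaqU_swap_sub_one_le)
open Literature.MathematicalPhysics.QuantumFieldTheory.Balaban1983to89.B9Eq373CurvComm (hasMajorant_comm_V₃_one)
open Literature.MathematicalPhysics.QuantumFieldTheory.Balaban1983to89.B6RandomWalk (BlockSupp)
open Literature.MathematicalPhysics.QuantumFieldTheory.Balaban1983to89.B9Eq386Neumann (eq384_sub)
open Literature.MathematicalPhysics.QuantumFieldTheory.Balaban1983to89.B9Ineq386CommSum (hasMajorant_GV_of_gradForm_comm_sum)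
open Literature.MathematicalPhysics.QuantumFieldTheory.Balaban1983to89.B9Ineq386V3Concrete (thm34_G_entries13_concreteV₃ norm_plaqU_adjacent_of_through)
open Literature.MathematicalPhysics.QuantumFieldTheory.Balaban1983to89.B9Ineq366CPrime (hasMajorant_rate_mono hasMajorant_comp_decay_left1)
open Literature.MathematicalPhysics.QuantumFieldTheory.Balaban1983to89.B9Thm34HolderLeftFinal (hasMajorant_pointProbe_mul
  probe_le_of_hasMajorant_pointProbe_mul norm_le_sum_norm_mul_of_repr_le coordProbe_apply)

/-! ## §1  The device: a solution of `(Δ_a(U) − V(A))G(U′U) = 1` with a right entry inherits the right-derivative Hölder member through the point probe -/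

section Device

variable {g : B9.Geometry} [Fintype g.Site] {R : ℝ} {H : Prop} {W : Type} [DecidableEq W] {K : Type}

set_option maxHeartbeats 800000 in
/-- **The right-derivative Hölder member survives the perturbation (3.84)–(3.86) — abstract device.**  Letters as in
`B9Ineq386CommSum.hasMajorant_GV_of_gradForm_comm_sum` (`V₃ = V⁰ + Σ_{k∈s}V¹_k∇_k`, (3.73) sizes, commutators `[V¹_k, ∇_k]`, (3.77) `P₁`,
(3.83) `P₂`, rates `ρ + (α+β)δ₀ ≦ δ`); `G(U)` with `G(U)Δ_a(U) = 1`; `G(U′U)` with `(Δ_a(U) − V(A))G(U′U) = 1` ((3.84) + (3.86)) and a right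
entry `G(U′U)D_s ≺ A₂Lʲηe^{−ρ₂d}`; a linear functional `φ` and a point `w₀` (block `y₀`) with the PROBE DATA (a) `|φ(G(U)μ)| ≦
B₀′(Lʲη)²e^{−δd(y₀,y′)}|μ|`, (b) `|φ(G(U)∇_kμ)| ≦ B₀′Lʲηe^{−δd}|μ|` (`k ∈ s`), (c) `|φ(G(U)D_sμ)| ≦ B₀′Lʲηe^{−δd}|μ|` (`supp μ ⊂ Δ(y′)`).  THEN
`|φ(G(U′U)D_sμ)| ≦ B₀′(1 + κ₃₈₅(1, c_V + Σc_K, κ₁, κ₂, Λ, c₁(δ₀,β))α₁·A₂·C·c₁(r₀,β′))·Lʲη·e^{−ρ₃d(y₀,y′)}|μ|` for every target rate `0 ≦ ρ₃ ≦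
min(ρ₂, δ)` with `ρ₃ + (α′+β′)r₀ ≦ ρ` (scale transfer of `Lʲη` at `(r₀, α′, C)`, (2.61) at `(r₀, β′)`).  PROOF: `G(U′U)D_s = G(U)D_s +
(G(U)V(A))(G(U′U)D_s)`; `X = single w₀ ∘ φ`; (a), (b) are the majorants `X·G(U) ≺ B₀′(Lʲη)²e^{−δd}`, `X·G(U)·∇_k ≺ B₀′Lʲηe^{−δd}` fed to the left
composite with `G := X·G(U)`: `(X·G(U))·V(A) ≺ κ₃₈₅(B₀′)α₁e^{−ρd}`; composition with the right entry; plus (c); read at `w₀`.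
[cite: Balaban1985BackgroundPropagators, Thm 3.4 p.400 + Thm 3.3 p.399 + (3.43) p.398 + (3.84)–(3.86) p.407 + (3.70)–(3.73) pp.404–405 + (3.77) p.406 + (3.83) p.407; Balaban1984PropagatorsII, (2.51)–(2.55) p.232 + Lemma 2.1 p.234] -/
theorem probeRight_of_inverse (blk : W → g.Site) (d : ℕ) (s : Finset K)
    (δ₀ δ α β ρ Λ cV κ₁ κ₂ α₁ r₀ α' β' C ρ₂ ρ₃ A₂ B₀' : ℝ) (c1 cK : K → ℝ)
    (hB₀' : 0 ≤ B₀') (hcV : 0 ≤ cV) (hκ₁ : 0 ≤ κ₁) (hκ₂ : 0 ≤ κ₂) (hα₁ : 0 ≤ α₁) (hΛ : 0 ≤ Λ) (hρ : 0 ≤ ρ)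
    (hα : 0 ≤ α) (hβ : 0 ≤ β) (hδ₀ : 0 ≤ δ₀) (hr : ρ + (α + β) * δ₀ ≤ δ)
    (hc1 : ∀ k ∈ s, 0 ≤ c1 k) (hsum : ∑ k ∈ s, c1 k ≤ cV) (hcK : ∀ k ∈ s, 0 ≤ cK k)
    (hC : 0 ≤ C) (hA₂ : 0 ≤ A₂) (hρ₃ : 0 ≤ ρ₃) (hρ₃ρ : ρ₃ + (α' + β') * r₀ ≤ ρ) (hρ₃₂ : ρ₃ ≤ ρ₂) (hρ₃δ : ρ₃ ≤ δ)
    (hdnn : ∀ a a' : g.Site, 0 ≤ g.dist a a') (htri : Triangle254 (toB6 g R H)) (hlen : ∀ y : g.Site, 0 < g.len y)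
    (h261 : Ineq261 d (toB6 g R H) δ₀ β) (h261c : Ineq261 d (toB6 g R H) r₀ β')
    (hT1i : ScaleTransfer g δ₀ α Λ (fun a => (g.len a)⁻¹)) (hT2i : ScaleTransfer g δ₀ α Λ (fun a => (g.len a ^ 2)⁻¹))
    (hTc : ScaleTransfer g r₀ α' C (fun a => g.len a))
    {G GExt Ds Δa V₃ V0 P₁ P₂ : Module.End ℝ (W → ℝ)} {V1 D : K → Module.End ℝ (W → ℝ)}
    (hV₃ : V₃ = V0 + ∑ k ∈ s, V1 k * D k)
    (hGΔ : G * Δa = 1) (hE : (Δa - vTotal V₃ P₁ P₂) * GExt = 1)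
    (hV0 : HasMajorant (g := toB6 g R H) blk V0
      (fun a a' => cV * α₁ * (g.len a ^ 2)⁻¹ * Real.exp (-(δ * g.dist a a'))))
    (hV1 : ∀ k ∈ s, HasMajorant (g := toB6 g R H) blk (V1 k)
      (fun a a' => c1 k * α₁ * (g.len a)⁻¹ * Real.exp (-(δ * g.dist a a'))))
    (hComm : ∀ k ∈ s, HasMajorant (g := toB6 g R H) blk (V1 k * D k - D k * V1 k)
      (fun a a' => cK k * α₁ * (g.len a ^ 2)⁻¹ * Real.exp (-(δ * g.dist a a'))))
    (hP₁ : HasMajorant (g := toB6 g R H) blk P₁ (fun a a' => κ₁ * α₁ * (g.len a ^ 2)⁻¹ * Real.exp (-(δ * g.dist a a'))))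
    (hP₂ : HasMajorant (g := toB6 g R H) blk P₂ (fun a a' => κ₂ * α₁ * (g.len a ^ 2)⁻¹ * Real.exp (-(δ * g.dist a a'))))
    (hEDs : HasMajorant (g := toB6 g R H) blk (GExt * Ds) (fun a a' => A₂ * g.len a * Real.exp (-(ρ₂ * g.dist a a'))))
    (φ : (W → ℝ) →ₗ[ℝ] ℝ) (w₀ : W)
    (hφG : ∀ (y' : g.Site) (μ : W → ℝ) (M : ℝ), BlockSupp (g := toB6 g R H) blk μ y' M →
      |φ (G μ)| ≤ B₀' * g.len (blk w₀) ^ 2 * Real.exp (-(δ * g.dist (blk w₀) y')) * M)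
    (hφGD : ∀ k ∈ s, ∀ (y' : g.Site) (μ : W → ℝ) (M : ℝ), BlockSupp (g := toB6 g R H) blk μ y' M →
      |φ ((G * D k) μ)| ≤ B₀' * g.len (blk w₀) * Real.exp (-(δ * g.dist (blk w₀) y')) * M)
    (hφGDs : ∀ (y' : g.Site) (μ : W → ℝ) (M : ℝ), BlockSupp (g := toB6 g R H) blk μ y' M →
      |φ ((G * Ds) μ)| ≤ B₀' * g.len (blk w₀) * Real.exp (-(δ * g.dist (blk w₀) y')) * M)
    (y' : g.Site) (μ : W → ℝ) (M : ℝ) (hμ : BlockSupp (g := toB6 g R H) blk μ y' M) :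
    |φ ((GExt * Ds) μ)| ≤
      B₀' * (1 + kappa385 1 (cV + ∑ k ∈ s, cK k) κ₁ κ₂ Λ (B6.c1 d δ₀ β) * α₁ * A₂ * C * B6.c1 d r₀ β') *
        g.len (blk w₀) * Real.exp (-(ρ₃ * g.dist (blk w₀) y')) * M := by
  -- (3.86) from the two inverse identities: `G(U′U) = G(U) + G(U)V(A)G(U′U)`, read on the right letter `D_s`
  have hGE : GExt = G + G * vTotal V₃ P₁ P₂ * GExt := by
    have e1 : G * ((Δa - vTotal V₃ P₁ P₂) * GExt) = G := by rw [hE, mul_one]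
    have e2 : G * ((Δa - vTotal V₃ P₁ P₂) * GExt) = GExt - G * vTotal V₃ P₁ P₂ * GExt := by
      rw [sub_mul, mul_sub, ← mul_assoc, hGΔ, one_mul, mul_assoc]
    rw [e2] at e1
    exact sub_eq_iff_eq_add.mp e1
  have hEDs' : GExt * Ds = G * Ds + G * vTotal V₃ P₁ P₂ * (GExt * Ds) := by
    conv_lhs => rw [hGE]
    rw [add_mul]
    simp only [mul_assoc]
  -- the point probe and the three majorants it inherits from (a), (b), (c)
  set X : Module.End ℝ (W → ℝ) := (LinearMap.single ℝ (fun _ : W => ℝ) w₀) ∘ₗ φ with hXdef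
  have hE₀ : ∀ (r : ℝ) (a a' : g.Site), 0 ≤ Real.exp (-(r * g.dist a a')) := fun r a a' => Real.exp_nonneg _
  have hX1 : HasMajorant (g := toB6 g R H) blk (X * G) (fun a a' => B₀' * g.len a ^ 2 * Real.exp (-(δ * g.dist a a'))) :=
    hasMajorant_pointProbe_mul (G := toB6 g R H) blk w₀ φ G _
      (fun a a' => mul_nonneg (mul_nonneg hB₀' (sq_nonneg _)) (hE₀ δ a a')) hφG
  have hX3 : ∀ k ∈ s, HasMajorant (g := toB6 g R H) blk (X * G * D k)
      (fun a a' => B₀' * g.len a * Real.exp (-(δ * g.dist a a'))) := by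
    intro k hk
    rw [mul_assoc]
    exact hasMajorant_pointProbe_mul (G := toB6 g R H) blk w₀ φ (G * D k) _
      (fun a a' => mul_nonneg (mul_nonneg hB₀' (hlen a).le) (hE₀ δ a a')) (hφGD k hk)
  have hXDs : HasMajorant (g := toB6 g R H) blk (X * (G * Ds)) (fun a a' => B₀' * g.len a * Real.exp (-(ρ₃ * g.dist a a'))) :=
    hasMajorant_rate_mono (R := R) (H := H) blk B₀' (fun a => g.len a) hB₀' (fun a => (hlen a).le) hρ₃δ hdnn
      (hasMajorant_pointProbe_mul (G := toB6 g R H) blk w₀ φ (G * Ds) _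
        (fun a a' => mul_nonneg (mul_nonneg hB₀' (hlen a).le) (hE₀ δ a a')) hφGDs)
  -- FILES 20/24's LEFT COMPOSITE (3.85) for the operator `X·G(U)`
  have hGV := hasMajorant_GV_of_gradForm_comm_sum (R := R) (H := H) blk d s δ₀ δ α β ρ Λ B₀' cV κ₁ κ₂ α₁ c1 cK hB₀' hcV
    hκ₁ hκ₂ hα₁ hΛ hρ hα hβ hδ₀ hr hc1 hsum hcK hdnn htri hlen h261 hT1i hT2i hV₃ hV0 hV1 hComm hP₁ hP₂ hX1 hX3
  have hθ0 : 0 ≤ kappa385 B₀' (cV + ∑ k ∈ s, cK k) κ₁ κ₂ Λ (B6.c1 d δ₀ β) * α₁ :=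
    mul_nonneg (kappa385_nonneg hB₀' (add_nonneg hcV (Finset.sum_nonneg hcK)) hκ₁ hκ₂ hΛ (B6RandomWalk.c1_nonneg d δ₀ β)) hα₁
  -- the right entry of `G(U′U)` at the target rate and the composition [4] (2.52)–(2.55)
  have hEDsρ := hasMajorant_rate_mono (R := R) (H := H) blk A₂ (fun a => g.len a) hA₂ (fun a => (hlen a).le) hρ₃₂ hdnn hEDs
  have hcomp := hasMajorant_comp_decay_left1 (R := R) (H := H) blk d r₀ α' β' ρ₃ ρ C
    (kappa385 B₀' (cV + ∑ k ∈ s, cK k) κ₁ κ₂ Λ (B6.c1 d δ₀ β) * α₁) A₂ (fun a => g.len a) (fun a => (hlen a).le) hC hθ0 hA₂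
    hρ₃ hρ₃ρ hdnn htri hTc h261c hGV hEDsρ
  -- `X·(G(U′U)D_s) = X·(G(U)D_s) + (X·G(U)·V(A))·(G(U′U)D_s)`
  have hsplit : X * (GExt * Ds) = X * (G * Ds) + X * G * vTotal V₃ P₁ P₂ * (GExt * Ds) := by
    conv_lhs => rw [hEDs']
    rw [mul_add]
    simp only [mul_assoc]
  have hfin : HasMajorant (g := toB6 g R H) blk (X * (GExt * Ds))
      (fun a a' => B₀' * (1 + kappa385 1 (cV + ∑ k ∈ s, cK k) κ₁ κ₂ Λ (B6.c1 d δ₀ β) * α₁ * A₂ * C * B6.c1 d r₀ β') *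
        g.len a * Real.exp (-(ρ₃ * g.dist a a'))) := by
    rw [hsplit]
    refine hasMajorant_mono (g := toB6 g R H) _ (hasMajorant_add (g := toB6 g R H) blk hXDs hcomp) fun a a' => le_of_eq ?_
    show B₀' * g.len a * Real.exp (-(ρ₃ * g.dist a a')) +
        kappa385 B₀' (cV + ∑ k ∈ s, cK k) κ₁ κ₂ Λ (B6.c1 d δ₀ β) * α₁ * A₂ * C * B6.c1 d r₀ β' * g.len a *
          Real.exp (-(ρ₃ * g.dist a a')) =
      B₀' * (1 + kappa385 1 (cV + ∑ k ∈ s, cK k) κ₁ κ₂ Λ (B6.c1 d δ₀ β) * α₁ * A₂ * C * B6.c1 d r₀ β') *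
        g.len a * Real.exp (-(ρ₃ * g.dist a a'))
    unfold kappa385
    ring
  have hread := probe_le_of_hasMajorant_pointProbe_mul (G := toB6 g R H) blk w₀ φ (GExt * Ds) _ hfin y' μ M hμ
  exact hread

end Device

/-! ## §2  THEOREM 3.4 × THEOREM 3.3, THE (3.43) MEMBER WITH THE DERIVATIVE ON THE RIGHT FOR THE CONCRETE `G(U′U)` OF gen 11 -/

section Concrete

variable {𝔸 : Type*} [NormedRing 𝔸] [NormedAlgebra ℂ 𝔸] [CompleteSpace 𝔸] {ι : Type} [Fintype ι]
variable (b : Module.Basis ι ℝ 𝔸) {S : Type} {κ : Type} [Fintype κ] [LinearOrder κ]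
variable (T : κ → Equiv.Perm S) (U : κ → S → 𝔸ˣ)
variable {g : B9.Geometry} [Fintype g.Site] {Rr : ℝ} {H : Prop}

set_option maxHeartbeats 1600000 in
/-- **THEOREM 3.4 × THEOREM 3.3: THE (3.43)-TYPE HÖLDER MEMBER OF `G(U′U)` WITH THE DERIVATIVE (THE RIGHT LETTER `D_s = ∇*`) ON THE RIGHT, FOR
THE CONCRETE PERTURBATION OF (3.82)** («‖ζG∇*_U J‖_β ≦ B₀(β₀)(Lʲη)^{1−β}(‖ζ‖_β^ξ + |ζ|)e^{−δ₀d(y,y′)}|J|», (3.43) p. 398 with Thm 3.3 p. 399, for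
`U′U`: «The extended operators satisfy all the inequalities of Theorems 3.1–3.3 correspondingly», p. 400).  HYPOTHESES = gen 11's
`B9Ineq386V3Concrete.thm34_G_entries13_concreteV₃` VERBATIM, plus a target rate `ρ₃` with `0 ≦ ρ₃ ≦ (1 − 3α′)ρ`.  CONCLUSION: ONE `G(U′U)` with
that theorem's four properties (two-sided inverse of `Δ_a(U′U)`, (3.42)₁ at `(1−α′)ρ`, (3.42)₃ at `(1−3α′)ρ`) AND, for it, `∀` `ℝ`-linear
`𝔸`-valued functional `Φ` of the bond function (a transported Hölder quotient (3.40) with cut-off, FILE 34 §3) `∀` anchor `y ∋ p₀` `∀ γ, B_h ≧ 0,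
c_ζ ≧ 0`: IF (a) `‖Φ(G(U)J)‖ ≦ B_h(Lʲη)^{2−γ}c_ζe^{−δd(y,y′)}|J|` (the quotient of `ζG(U)J` itself — from (3.42)₂ in print, an input here),
(b) `‖Φ(G(U)∇_kJ)‖ ≦ B_h(Lʲη)^{1−γ}c_ζe^{−δd(y,y′)}|J|` for the `2d` concrete difference letters `∇_k = conj b (diffLetter (bT T) (bU U) η⁻¹ k)`
and (c) the same for `G(U)D_s`, THEN `‖Φ(G(U′U)D_sJ)‖ ≦ B·B_h(Lʲη)^{1−γ}c_ζe^{−ρ₃d(y,y′)}|J|` with `B = (Σ_i‖b_i‖)M₂(1 +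
κ₃₈₅(1)α₁·A₂·Λ_ρ·c₁(ρ,α′))`, `A₂ = B₀Λ_ρ²c₁(ρ,α′)(1 − κ₃₈₅′α₁c₁(ρ,α′))⁻¹`.  PROOF: the `V₃`-side identifications of gen 11 (copied from the
proof of `thm34_G_entries13_concreteV₃`), (3.84) for the concrete letters (`eq384_sub`), then §1 coordinate by coordinate with `B₀′ =
M₂B_h(Lʲη)^{−γ}c_ζ` and the norm from the coordinates (FILE 34 §2).  HONEST SCOPE: module header (a)–(d).
[cite: Balaban1985BackgroundPropagators, Thm 3.4 p.400 + Thm 3.3 p.399 + Thm 3.1 (3.40)/(3.42)–(3.43) pp.397–398 + (3.82)–(3.86) p.407 + (3.70)–(3.73) pp.404–405 + (3.37)/(3.35) p.396; Balaban1984PropagatorsII, (2.51)–(2.55) p.232 + Lemma 2.1 p.234; Balaban1985Variational, (135) p.298] -/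
theorem thm34_G_holderRight_concreteV₃ [Fintype S] [DecidableEq S] [DecidableEq ι] (blk : S → g.Site) (d : ℕ)
    (δ₀ δ α β ρ α' Λ Λρ B₀ κ₁ κ₂ α₁ C₀ d₀ M₂ : ℝ)
    (hB₀ : 0 ≤ B₀) (hκ₁ : 0 ≤ κ₁) (hκ₂ : 0 ≤ κ₂) (hα₁ : 0 ≤ α₁) (hC₀ : 0 ≤ C₀) (hΛ : 0 ≤ Λ) (hΛρ : 0 ≤ Λρ) (hρ : 0 ≤ ρ)
    (hα : 0 ≤ α) (hβ : 0 ≤ β) (hδ₀ : 0 ≤ δ₀) (hδ : 0 ≤ δ) (hM₂ : 0 ≤ M₂) (hr : ρ + (α + β) * δ₀ ≤ δ) (hα' : α' ≤ 1)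
    (hα'ρ0 : 0 ≤ α' * ρ) (hα'ρ2 : 0 ≤ (1 - 2 * α') * ρ)
    (hdnn : ∀ a a' : g.Site, 0 ≤ g.dist a a') (htri : Triangle254 (toB6 g Rr H)) (hrefl : ∀ y : g.Site, g.dist y y = 0)
    (hsym : ∀ y y' : g.Site, g.dist y y' = g.dist y' y) (hlen : ∀ y : g.Site, 0 < g.len y)
    (h261 : Ineq261 d (toB6 g Rr H) δ₀ β) (h261' : Ineq261 d (toB6 g Rr H) ρ α')
    (hT1 : ScaleTransfer g δ₀ α Λ (fun a => g.len a)) (hT2 : ScaleTransfer g δ₀ α Λ (fun a => g.len a ^ 2))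
    (hT1i : ScaleTransfer g δ₀ α Λ (fun a => (g.len a)⁻¹)) (hT2i : ScaleTransfer g δ₀ α Λ (fun a => (g.len a ^ 2)⁻¹))
    (hTρ : ScaleTransfer g ρ α' Λρ (fun a => g.len a))
    (hsmall385 : kappa385 B₀
        (cV385 (Fintype.card κ) α₁ C₀ (M₂ * (∑ i, ‖b i‖) * Real.exp (δ * d₀))
          + ∑ _k ∈ (Finset.univ : Finset (κ ⊕ κ)),
            (10 + 8 * Fintype.card κ + (16 * Fintype.card κ + 12) * C₀) * (M₂ * (∑ i, ‖b i‖) * Real.exp (δ * d₀)))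
        κ₁ κ₂ Λ (B6.c1 d δ₀ β) * α₁ * B6.c1 d ρ α' < 1)
    (hrepr : ∀ (v : 𝔸) (i : ι), |b.repr v i| ≤ M₂ * ‖v‖) (hη : 0 < g.eta) (hL : 1 ≤ g.L) (A : κ → S → 𝔸)
    (hT : ∀ (μ ν : κ) (x : S), T μ (T ν x) = T ν (T μ x))
    (hsmall : ∀ y : g.Site, g.eta * (α₁ * (g.len y)⁻¹) ≤ 1 / 4)
    (hU1 : ∀ m z, ‖((U m z : 𝔸ˣ) : 𝔸)‖ ≤ 1 ∧ ‖(((U m z)⁻¹ : 𝔸ˣ) : 𝔸)‖ ≤ 1)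
    -- (3.37) for the exponent field, blockwise, in the shapes files 1–7 read it
    (h337B : ∀ ν k x, ‖((g.eta : ℂ)⁻¹) • covDstar T U ν (A k) x‖ ≤ α₁ * (g.len (blk x) ^ 2)⁻¹)
    (h337F : ∀ μ ν x, ‖((g.eta : ℂ)⁻¹) • covD T U μ (A ν) x‖ ≤ α₁ * (g.len (blk x) ^ 2)⁻¹)
    (h337B' : ∀ μ ν x, ‖((g.eta : ℂ)⁻¹) • covDstar T U ν (A ν) (T μ x)‖ ≤ α₁ * (g.len (blk x) ^ 2)⁻¹)
    (h337Bτ : ∀ μ x, ‖((g.eta : ℂ)⁻¹) • covDstar T U μ (tauB T U μ (A μ)) x‖ ≤ α₁ * (g.len (blk x) ^ 2)⁻¹)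
    (h337FB : ∀ μ ν k x, ‖((g.eta : ℂ)⁻¹) • covD T U μ (A k) ((T ν).symm x)‖ ≤ α₁ * (g.len (blk x) ^ 2)⁻¹)
    (hA : ∀ k x, ‖A k x‖ ≤ α₁ * (g.len (blk x))⁻¹) (hAτB : ∀ ν k x, ‖tauB T U ν (A k) x‖ ≤ α₁ * (g.len (blk x))⁻¹)
    (hAτF : ∀ μ k x, ‖tauF T U μ (A k) x‖ ≤ α₁ * (g.len (blk x))⁻¹)
    (hAFB : ∀ k μ ν x, ‖A k ((T ν).symm (T μ x))‖ ≤ α₁ * (g.len (blk x))⁻¹)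
    (hAst : ∀ μ x m z, (m, z) ∈ stBonds T μ x → ‖A m z‖ ≤ α₁ * (g.len (blk x))⁻¹)
    (hAloc : ∀ μ x m z, (m, z) ∈ B9Eq375Locality.locBondsA T μ x → ‖A m z‖ ≤ α₁ * (g.len (blk x))⁻¹)
    (hdAst : ∀ μ x m n y, Through T μ x m n y →
      ‖covD T U m (A n) y‖ ≤ g.eta * (α₁ * ((g.len (blk x))⁻¹) ^ 2) ∧
        ‖covD T U n (A m) y‖ ≤ g.eta * (α₁ * ((g.len (blk x))⁻¹) ^ 2))
    -- (3.35) on the plaquettes through each bond, at that bond's block scale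
    (h35 : ∀ μ x m n y, Through T μ x m n y → ‖(plaqU T U m n y : 𝔸) - 1‖ ≤ C₀ * ((g.L ^ g.scale (blk x))⁻¹) ^ 2)
    -- stencil geometry
    (hd₀B : ∀ μ x, g.dist (blk x) (blk ((T μ).symm x)) ≤ d₀) (hd₀F : ∀ μ x, g.dist (blk x) (blk (T μ x)) ≤ d₀)
    (hd₀FB : ∀ μ ν x, g.dist (blk x) (blk ((T ν).symm (T μ x))) ≤ d₀)
    (hd₀st : ∀ μ x (q : κ × S), q ∈ stBonds T μ x → g.dist (blk x) (blk q.2) ≤ d₀)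
    (hd₀loc : ∀ μ x (q : κ × S), q ∈ B9Eq375Locality.locBondsA' T μ x → g.dist (blk x) (blk q.2) ≤ d₀)
    (hd₀0 : ∀ y : g.Site, g.dist y y ≤ d₀)
    -- the abstract data of (3.76)/(3.80), the inverse property and Theorem 3.3 for G(U)
    {G Ds P₁ P₂ DRDs DRDs' Qs Qs' Q Q' a F₂ F₂s : Module.End ℝ ((κ × S) × ι → ℝ)}
    (h376 : DRDs' = DRDs - conj b (V₂Op T U g.eta A) - P₁) (h380 : Q' = Q + F₂) (h380s : Qs' = Qs + F₂s)
    (hP₂def : P₂ = pTwo Qs Q F₂ F₂s a)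
    (hΔG : deltaA (conj b (lapDDLetter T ((g.eta : ℂ)⁻¹) U)) (conj b (dPrimeLetter T U g.eta)) DRDs Qs a Q * G = 1)
    (hGΔ : G * deltaA (conj b (lapDDLetter T ((g.eta : ℂ)⁻¹) U)) (conj b (dPrimeLetter T U g.eta)) DRDs Qs a Q = 1)
    (hP₁ : HasMajorant (g := toB6 g Rr H) (fun q : (κ × S) × ι => blk q.1.2) P₁
      (fun a a' => κ₁ * α₁ * (g.len a ^ 2)⁻¹ * Real.exp (-(δ * g.dist a a'))))
    (hP₂ : HasMajorant (g := toB6 g Rr H) (fun q : (κ × S) × ι => blk q.1.2) P₂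
      (fun a a' => κ₂ * α₁ * (g.len a ^ 2)⁻¹ * Real.exp (-(δ * g.dist a a'))))
    (hG : HasMajorant (g := toB6 g Rr H) (fun q : (κ × S) × ι => blk q.1.2) G
      (fun a a' => B₀ * g.len a ^ 2 * Real.exp (-(δ * g.dist a a'))))
    (hDG : ∀ k : κ ⊕ κ, HasMajorant (g := toB6 g Rr H) (fun q : (κ × S) × ι => blk q.1.2)
      (conj b (diffLetter (bT T) (bU U) ((g.eta : ℂ)⁻¹) k) * G) (fun a a' => B₀ * g.len a * Real.exp (-(δ * g.dist a a'))))
    (hGD : ∀ k : κ ⊕ κ, HasMajorant (g := toB6 g Rr H) (fun q : (κ × S) × ι => blk q.1.2)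
      (G * conj b (diffLetter (bT T) (bU U) ((g.eta : ℂ)⁻¹) k)) (fun a a' => B₀ * g.len a * Real.exp (-(δ * g.dist a a'))))
    (hGDs : HasMajorant (g := toB6 g Rr H) (fun q : (κ × S) × ι => blk q.1.2) (G * Ds)
      (fun a a' => B₀ * g.len a * Real.exp (-(δ * g.dist a a'))))
    -- NEW: the target rate of the Hölder member
    (ρ₃ : ℝ) (hρ₃ : 0 ≤ ρ₃) (hρ₃' : ρ₃ ≤ (1 - 3 * α') * ρ) :
    ∃ GExt : Module.End ℝ ((κ × S) × ι → ℝ),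
      deltaA (conj b (lapDDLetter T ((g.eta : ℂ)⁻¹) (prodCfg U g.eta A)))
          (conj b (dPrimeLetter T (prodCfg U g.eta A) g.eta)) DRDs' Qs' a Q' * GExt = 1 ∧
      GExt * deltaA (conj b (lapDDLetter T ((g.eta : ℂ)⁻¹) (prodCfg U g.eta A)))
          (conj b (dPrimeLetter T (prodCfg U g.eta A) g.eta)) DRDs' Qs' a Q' = 1 ∧
      HasMajorant (g := toB6 g Rr H) (fun q : (κ × S) × ι => blk q.1.2) GExt
        (fun a a' => B₀ * B6.c1 d ρ α' *
          (1 - kappa385 B₀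
            (cV385 (Fintype.card κ) α₁ C₀ (M₂ * (∑ i, ‖b i‖) * Real.exp (δ * d₀))
              + ∑ _k ∈ (Finset.univ : Finset (κ ⊕ κ)),
                (10 + 8 * Fintype.card κ + (16 * Fintype.card κ + 12) * C₀) * (M₂ * (∑ i, ‖b i‖) * Real.exp (δ * d₀)))
            κ₁ κ₂ Λ (B6.c1 d δ₀ β) * α₁ * B6.c1 d ρ α')⁻¹ *
          g.len a ^ 2 * Real.exp (-((1 - α') * ρ * g.dist a a'))) ∧
      HasMajorant (g := toB6 g Rr H) (fun q : (κ × S) × ι => blk q.1.2) (GExt * Ds)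
        (fun a a' => B₀ * Λρ ^ 2 * B6.c1 d ρ α' *
          (1 - kappa385 B₀
            (cV385 (Fintype.card κ) α₁ C₀ (M₂ * (∑ i, ‖b i‖) * Real.exp (δ * d₀))
              + ∑ _k ∈ (Finset.univ : Finset (κ ⊕ κ)),
                (10 + 8 * Fintype.card κ + (16 * Fintype.card κ + 12) * C₀) * (M₂ * (∑ i, ‖b i‖) * Real.exp (δ * d₀)))
            κ₁ κ₂ Λ (B6.c1 d δ₀ β) * α₁ * B6.c1 d ρ α')⁻¹ *
          g.len a * Real.exp (-((1 - 3 * α') * ρ * g.dist a a'))) ∧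
      -- NEW: the (3.43)-type Hölder member with the derivative (the right letter `D_s`) on the RIGHT, for this `G(U′U)`
      ∀ (Φ : (κ × S → 𝔸) →ₗ[ℝ] 𝔸) (y : g.Site) (p₀ : (κ × S) × ι), blk p₀.1.2 = y →
      ∀ (γ Bh cζ : ℝ), 0 ≤ Bh → 0 ≤ cζ →
        -- (a) the (3.40) quotient of `ζG(U)J` itself (from (3.42)₂ in print; an input here)
        (∀ (y' : g.Site) (μ : (κ × S) × ι → ℝ) (M : ℝ), BlockSupp (g := toB6 g Rr H) (fun q : (κ × S) × ι => blk q.1.2) μ y' M →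
          ‖Φ ((coordEquiv b).symm (G μ))‖ ≤ Bh * g.len y ^ (2 - γ) * cζ * Real.exp (-(δ * g.dist y y')) * M) →
        -- (b) the member «‖ζG(U)∇_kJ‖_β» for every concrete difference letter
        (∀ (k : κ ⊕ κ) (y' : g.Site) (μ : (κ × S) × ι → ℝ) (M : ℝ), BlockSupp (g := toB6 g Rr H) (fun q : (κ × S) × ι => blk q.1.2) μ y' M →
          ‖Φ ((coordEquiv b).symm ((G * conj b (diffLetter (bT T) (bU U) ((g.eta : ℂ)⁻¹) k)) μ))‖ ≤
            Bh * g.len y ^ (1 - γ) * cζ * Real.exp (-(δ * g.dist y y')) * M) →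
        -- (c) the member for the right letter `D_s`
        (∀ (y' : g.Site) (μ : (κ × S) × ι → ℝ) (M : ℝ), BlockSupp (g := toB6 g Rr H) (fun q : (κ × S) × ι => blk q.1.2) μ y' M →
          ‖Φ ((coordEquiv b).symm ((G * Ds) μ))‖ ≤ Bh * g.len y ^ (1 - γ) * cζ * Real.exp (-(δ * g.dist y y')) * M) →
        ∀ (y' : g.Site) (μ : (κ × S) × ι → ℝ) (M : ℝ), BlockSupp (g := toB6 g Rr H) (fun q : (κ × S) × ι => blk q.1.2) μ y' M →
          ‖Φ ((coordEquiv b).symm ((GExt * Ds) μ))‖ ≤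
            (∑ i, ‖b i‖) * M₂ *
              (1 + kappa385 1
                (cV385 (Fintype.card κ) α₁ C₀ (M₂ * (∑ i, ‖b i‖) * Real.exp (δ * d₀))
                  + ∑ _k ∈ (Finset.univ : Finset (κ ⊕ κ)),
                    (10 + 8 * Fintype.card κ + (16 * Fintype.card κ + 12) * C₀) * (M₂ * (∑ i, ‖b i‖) * Real.exp (δ * d₀)))
                κ₁ κ₂ Λ (B6.c1 d δ₀ β) * α₁ *
                (B₀ * Λρ ^ 2 * B6.c1 d ρ α' *
                  (1 - kappa385 B₀
                    (cV385 (Fintype.card κ) α₁ C₀ (M₂ * (∑ i, ‖b i‖) * Real.exp (δ * d₀))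
                  + ∑ _k ∈ (Finset.univ : Finset (κ ⊕ κ)),
                    (10 + 8 * Fintype.card κ + (16 * Fintype.card κ + 12) * C₀) * (M₂ * (∑ i, ‖b i‖) * Real.exp (δ * d₀)))
                    κ₁ κ₂ Λ (B6.c1 d δ₀ β) * α₁ * B6.c1 d ρ α')⁻¹) * Λρ * B6.c1 d ρ α') *
              Bh * g.len y ^ (1 - γ) * cζ * Real.exp (-(ρ₃ * g.dist y y')) * M := by
  classical
  -- the constants of the concrete (3.73)/(3.37) letters (as in the proof of `thm34_G_entries13_concreteV₃`)
  set Mc : ℝ := M₂ * (∑ i, ‖b i‖) * Real.exp (δ * d₀) with hMc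
  have hbsum : 0 ≤ ∑ i, ‖b i‖ := Finset.sum_nonneg fun i _ => norm_nonneg _
  have hMc0 : 0 ≤ Mc := by positivity
  have hcV0 := cV0_nonneg (Fintype.card κ) hα₁ hC₀
  have hcV := cV385_nonneg (Fintype.card κ) hα₁ hC₀ hMc0
  have hcK0 : 0 ≤ (10 + 8 * Fintype.card κ + (16 * Fintype.card κ + 12) * C₀) * Mc := by positivity
  -- ONE `G(U′U)` with its four properties (gen 11)
  obtain ⟨GExt, e1, e2, hGE1, hGEDs⟩ := thm34_G_entries13_concreteV₃ (Rr := Rr) (H := H) b T U blk d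
    δ₀ δ α β ρ α' Λ Λρ B₀ κ₁ κ₂ α₁ C₀ d₀ M₂ hB₀ hκ₁ hκ₂ hα₁ hC₀ hΛ hΛρ hρ hα hβ hδ₀ hδ hM₂ hr hα' hα'ρ0 hα'ρ2 hdnn htri hrefl hsym hlen h261 h261' hT1 hT2 hT1i hT2i hTρ hsmall385 hrepr hη hL A hT hsmall hU1 h337B h337F h337B' h337Bτ h337FB hA hAτB hAτF hAFB hAst hAloc hdAst h35 hd₀B hd₀F hd₀FB hd₀st hd₀loc hd₀0 h376 h380 h380s hP₂def hΔG hGΔ hP₁ hP₂ hG hDG hGD hGDs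
  refine ⟨GExt, e1, e2, hGE1, hGEDs, ?_⟩
  intro Φ y p₀ hp₀ γ Bh cζ hBh hcζ h0 hR hD y' μ M hμ
  subst hp₀
  -- the `V₃`-side identifications of the concrete perturbation (gen 11, files 1–7)
  have h35adj := norm_plaqU_adjacent_of_through T U blk hC₀ hU1 h35
  have hV₃ := conj_V₃Op_eq_gradForm T U b g.eta A
  have hV₃' := conj_V₃Op_eq_vThree T U b g.eta A
  have h371 := conj_lapDDLetter_prodCfg (b := b) (T := T) (U := U) hη.ne' A
  have hV0 := hasMajorant_V₃_zero (Rr := Rr) (H := H) b T U blk hη hL A C₀ d₀ δ M₂ α₁ hα₁ hC₀ hδ hM₂ hrepr hlen hsmall hU1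
    h337B h337F h337B' hAst hAloc hdAst h35 hd₀B hd₀F hd₀FB hd₀st hd₀loc hd₀0
  have hV1 := hasMajorant_V₃_one (Rr := Rr) (H := H) b T U blk A d₀ δ M₂ α₁ hα₁ hδ hM₂ hrepr hlen hA hAτB hAτF hU1 hd₀B hd₀F hd₀0
  have hComm := hasMajorant_comm_V₃_one (Rr := Rr) (H := H) b T U blk hη hL A C₀ d₀ δ M₂ α₁ hα₁ hC₀ hδ hM₂ hrepr hT hU1 hA hAτB
    hAτF hAFB h337F h337B h337B' h337Bτ h337FB h35adj hd₀B hd₀F hd₀FB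
  have hV0' : HasMajorant (g := toB6 g Rr H) (fun q : (κ × S) × ι => blk q.1.2)
      (conj b (zeroLetter T U ((g.eta : ℂ)⁻¹) A + F₁Letter T U g.eta A)
        - conj b (dPrimeLetter T (prodCfg U g.eta A) g.eta - dPrimeLetter T U g.eta)
        + conj b (zeroLetter₂ T U ((g.eta : ℂ)⁻¹) A + F₂Letter T U g.eta A))
      (fun a a' => cV385 (Fintype.card κ) α₁ C₀ Mc * α₁ * (g.len a ^ 2)⁻¹ * Real.exp (-(δ * g.dist a a'))) := by
    refine hasMajorant_mono (g := toB6 g Rr H) _ hV0 fun z z' => ?_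
    have h0' : 0 ≤ 28 * (Fintype.card κ : ℝ) * (Fintype.card κ + 1) * Mc * α₁ * (g.len z ^ 2)⁻¹ * Real.exp (-(δ * g.dist z z')) := by
      positivity
    have e : cV385 (Fintype.card κ) α₁ C₀ Mc * α₁ * (g.len z ^ 2)⁻¹ * Real.exp (-(δ * g.dist z z'))
        = cV0 (Fintype.card κ) α₁ C₀ * M₂ * (∑ i, ‖b i‖) * Real.exp (δ * d₀) * α₁ * (g.len z ^ 2)⁻¹ *
            Real.exp (-(δ * g.dist z z'))
          + 28 * (Fintype.card κ : ℝ) * (Fintype.card κ + 1) * Mc * α₁ * (g.len z ^ 2)⁻¹ * Real.exp (-(δ * g.dist z z')) := by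
      rw [hMc]; unfold cV385; ring
    rw [e]
    linarith
  have hsum : ∑ _k ∈ (Finset.univ : Finset (κ ⊕ κ)), 14 * ((Fintype.card κ : ℝ) + 1) * M₂ * (∑ i, ‖b i‖) * Real.exp (δ * d₀)
      ≤ cV385 (Fintype.card κ) α₁ C₀ Mc := by
    rw [Finset.sum_const, Finset.card_univ, Fintype.card_sum, nsmul_eq_mul, Nat.cast_add]
    have h0' : 0 ≤ cV0 (Fintype.card κ) α₁ C₀ * Mc := mul_nonneg hcV0 hMc0
    have e : cV385 (Fintype.card κ) α₁ C₀ Mc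
        = cV0 (Fintype.card κ) α₁ C₀ * Mc
          + ((Fintype.card κ : ℝ) + Fintype.card κ) * (14 * ((Fintype.card κ : ℝ) + 1) * M₂ * (∑ i, ‖b i‖) *
            Real.exp (δ * d₀)) := by
      rw [hMc]; unfold cV385; ring
    rw [e]
    linarith
  -- (3.84) for the concrete letters, `Δ_a(U′U) = Δ_a(U) − V(A)`, hence `(Δ_a(U) − V(A))G(U′U) = 1`
  have h384 : deltaA (conj b (lapDDLetter T ((g.eta : ℂ)⁻¹) (prodCfg U g.eta A)))
        (conj b (dPrimeLetter T (prodCfg U g.eta A) g.eta)) DRDs' Qs' a Q' =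
      deltaA (conj b (lapDDLetter T ((g.eta : ℂ)⁻¹) U)) (conj b (dPrimeLetter T U g.eta)) DRDs Qs a Q -
        vTotal (conj b (V₃Op T U g.eta A)) P₁ P₂ := by
    rw [eq384_sub (conj b (lapDDLetter T ((g.eta : ℂ)⁻¹) U)) (conj b (lapDDLetter T ((g.eta : ℂ)⁻¹) (prodCfg U g.eta A)))
      (conj b (dPrimeLetter T U g.eta)) (conj b (dPrimeLetter T (prodCfg U g.eta A) g.eta)) DRDs DRDs' Qs Qs' Q Q' a
      (conj b (V₁Op T U g.eta A)) (conj b (V₂Op T U g.eta A)) P₁ F₂ F₂s h371 h376 h380 h380s, hV₃', hP₂def]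
  have hE' : (deltaA (conj b (lapDDLetter T ((g.eta : ℂ)⁻¹) U)) (conj b (dPrimeLetter T U g.eta)) DRDs Qs a Q -
        vTotal (conj b (V₃Op T U g.eta A)) P₁ P₂) * GExt = 1 := by
    rw [← h384]; exact e1
  -- rates and the right-entry constant
  have hρ₃ρ : ρ₃ + (α' + α') * ρ ≤ ρ := by
    have e1' : (1 - 3 * α') * ρ = ρ - 3 * (α' * ρ) := by ring
    have e2' : (α' + α') * ρ = 2 * (α' * ρ) := by ring
    linarith
  have hρ₃δ : ρ₃ ≤ δ := by
    have e1' : (1 - 3 * α') * ρ = ρ - 3 * (α' * ρ) := by ring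
    have : 0 ≤ (α + β) * δ₀ := by positivity
    linarith
  have hx1 := sub_pos.mpr hsmall385
  have hA₂0 : 0 ≤ (B₀ * Λρ ^ 2 * B6.c1 d ρ α' *
            (1 - kappa385 B₀ (cV385 (Fintype.card κ) α₁ C₀ Mc
              + ∑ _k ∈ (Finset.univ : Finset (κ ⊕ κ)), (10 + 8 * Fintype.card κ + (16 * Fintype.card κ + 12) * C₀) * Mc) κ₁ κ₂ Λ (B6.c1 d δ₀ β) * α₁ * B6.c1 d ρ α')⁻¹) :=
    mul_nonneg (mul_nonneg (mul_nonneg hB₀ (sq_nonneg _)) (B6RandomWalk.c1_nonneg d ρ α')) (inv_nonneg.mpr hx1.le)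
  -- the constant of the point-probe composites and the rescalings of the printed weights
  have hℓ : 0 < g.len (blk p₀.1.2) := hlen _
  set B₀' : ℝ := M₂ * (Bh * g.len (blk p₀.1.2) ^ (1 - γ) * cζ) * (g.len (blk p₀.1.2))⁻¹ with hB₀'def
  have hB₀'0 : 0 ≤ B₀' :=
    mul_nonneg (mul_nonneg hM₂ (mul_nonneg (mul_nonneg hBh (Real.rpow_nonneg hℓ.le _)) hcζ)) (inv_nonneg.mpr hℓ.le)
  have hpow : g.len (blk p₀.1.2) ^ (2 - γ) = g.len (blk p₀.1.2) ^ (1 - γ) * g.len (blk p₀.1.2) := by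
    rw [show (2 : ℝ) - γ = (1 - γ) + 1 by ring, Real.rpow_add hℓ, Real.rpow_one]
  have hB1 : B₀' * g.len (blk p₀.1.2) = M₂ * (Bh * g.len (blk p₀.1.2) ^ (1 - γ) * cζ) := by
    rw [hB₀'def]; field_simp
  have hB2 : B₀' * g.len (blk p₀.1.2) ^ 2 = M₂ * (Bh * g.len (blk p₀.1.2) ^ (2 - γ) * cζ) := by
    rw [hpow, hB₀'def]; field_simp
  -- per real coordinate `i` of `Φ`: §1 for the functional `b.coord i ∘ Φ ∘ coord⁻¹`
  have hcoord : ∀ i : ι,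
      |((b.coord i) ∘ₗ Φ ∘ₗ (coordEquiv (S := κ × S) b).symm.toLinearMap) ((GExt * Ds) μ)| ≤
        B₀' * (1 + kappa385 1 (cV385 (Fintype.card κ) α₁ C₀ Mc
              + ∑ _k ∈ (Finset.univ : Finset (κ ⊕ κ)), (10 + 8 * Fintype.card κ + (16 * Fintype.card κ + 12) * C₀) * Mc) κ₁ κ₂ Λ (B6.c1 d δ₀ β) * α₁ *
            (B₀ * Λρ ^ 2 * B6.c1 d ρ α' *
            (1 - kappa385 B₀ (cV385 (Fintype.card κ) α₁ C₀ Mc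
              + ∑ _k ∈ (Finset.univ : Finset (κ ⊕ κ)), (10 + 8 * Fintype.card κ + (16 * Fintype.card κ + 12) * C₀) * Mc) κ₁ κ₂ Λ (B6.c1 d δ₀ β) * α₁ * B6.c1 d ρ α')⁻¹) * Λρ * B6.c1 d ρ α') *
          g.len (blk p₀.1.2) * Real.exp (-(ρ₃ * g.dist (blk p₀.1.2) y')) * M := by
    intro i
    refine probeRight_of_inverse (R := Rr) (H := H) (fun q : (κ × S) × ι => blk q.1.2) d Finset.univ δ₀ δ α β ρ Λ
      (cV385 (Fintype.card κ) α₁ C₀ Mc) κ₁ κ₂ α₁ ρ α' α' Λρ ((1 - 3 * α') * ρ) ρ₃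
      (B₀ * Λρ ^ 2 * B6.c1 d ρ α' *
            (1 - kappa385 B₀ (cV385 (Fintype.card κ) α₁ C₀ Mc
              + ∑ _k ∈ (Finset.univ : Finset (κ ⊕ κ)), (10 + 8 * Fintype.card κ + (16 * Fintype.card κ + 12) * C₀) * Mc) κ₁ κ₂ Λ (B6.c1 d δ₀ β) * α₁ * B6.c1 d ρ α')⁻¹) B₀'
      (fun _ => 14 * ((Fintype.card κ : ℝ) + 1) * M₂ * (∑ i, ‖b i‖) * Real.exp (δ * d₀))
      (fun _ => (10 + 8 * Fintype.card κ + (16 * Fintype.card κ + 12) * C₀) * Mc)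
      hB₀'0 hcV hκ₁ hκ₂ hα₁ hΛ hρ hα hβ hδ₀ hr (fun k _ => by positivity) hsum (fun k _ => hcK0) hΛρ hA₂0 hρ₃ hρ₃ρ hρ₃' hρ₃δ
      hdnn htri hlen h261 h261' hT1i hT2i hTρ
      (V1 := fun k => conj b (V1Letter T U A k) + conj b (V1Letter₂ T U A k))
      (D := fun k => conj b (diffLetter (bT T) (bU U) ((g.eta : ℂ)⁻¹) k))
      hV₃ hGΔ hE' hV0' (fun k _ => hV1 k)
      (fun k _ => hasMajorant_mono (g := toB6 g Rr H) _ (hComm k) fun z z' => le_of_eq (by rw [hMc]; ring))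
      hP₁ hP₂ hGEDs ((b.coord i) ∘ₗ Φ ∘ₗ (coordEquiv (S := κ × S) b).symm.toLinearMap) p₀ ?_ ?_ ?_ y' μ M hμ
    · -- (a) ⇒ `|φᵢ(G(U)ν)| ≦ B₀′(Lʲη)²e^{−δd}|ν|`
      intro z ν C hν
      rw [coordProbe_apply]
      calc |b.repr (Φ ((coordEquiv b).symm (G ν))) i| ≤ M₂ * ‖Φ ((coordEquiv b).symm (G ν))‖ := hrepr _ _
        _ ≤ M₂ * (Bh * g.len (blk p₀.1.2) ^ (2 - γ) * cζ * Real.exp (-(δ * g.dist (blk p₀.1.2) z)) * C) :=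
            mul_le_mul_of_nonneg_left (h0 z ν C hν) hM₂
        _ = B₀' * g.len (blk p₀.1.2) ^ 2 * Real.exp (-(δ * g.dist (blk p₀.1.2) z)) * C := by rw [hB2]; ring
    · -- (b) ⇒ `|φᵢ(G(U)∇_kν)| ≦ B₀′Lʲηe^{−δd}|ν|`
      intro k _ z ν C hν
      rw [coordProbe_apply]
      calc |b.repr (Φ ((coordEquiv b).symm ((G * conj b (diffLetter (bT T) (bU U) ((g.eta : ℂ)⁻¹) k)) ν))) i|
          ≤ M₂ * ‖Φ ((coordEquiv b).symm ((G * conj b (diffLetter (bT T) (bU U) ((g.eta : ℂ)⁻¹) k)) ν))‖ := hrepr _ _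
        _ ≤ M₂ * (Bh * g.len (blk p₀.1.2) ^ (1 - γ) * cζ * Real.exp (-(δ * g.dist (blk p₀.1.2) z)) * C) :=
            mul_le_mul_of_nonneg_left (hR k z ν C hν) hM₂
        _ = B₀' * g.len (blk p₀.1.2) * Real.exp (-(δ * g.dist (blk p₀.1.2) z)) * C := by rw [hB1]; ring
    · -- (c) ⇒ `|φᵢ(G(U)D_sν)| ≦ B₀′Lʲηe^{−δd}|ν|`
      intro z ν C hν
      rw [coordProbe_apply]
      calc |b.repr (Φ ((coordEquiv b).symm ((G * Ds) ν))) i| ≤ M₂ * ‖Φ ((coordEquiv b).symm ((G * Ds) ν))‖ := hrepr _ _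
        _ ≤ M₂ * (Bh * g.len (blk p₀.1.2) ^ (1 - γ) * cζ * Real.exp (-(δ * g.dist (blk p₀.1.2) z)) * C) :=
            mul_le_mul_of_nonneg_left (hD z ν C hν) hM₂
        _ = B₀' * g.len (blk p₀.1.2) * Real.exp (-(δ * g.dist (blk p₀.1.2) z)) * C := by rw [hB1]; ring
  -- from the coordinates to the norm
  have hn := norm_le_sum_norm_mul_of_repr_le b (Φ ((coordEquiv b).symm ((GExt * Ds) μ))) _ (fun i => by
    simpa only [coordProbe_apply] using hcoord i)
  calc ‖Φ ((coordEquiv b).symm ((GExt * Ds) μ))‖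
      ≤ (∑ i, ‖b i‖) * (B₀' * (1 + kappa385 1 (cV385 (Fintype.card κ) α₁ C₀ Mc
              + ∑ _k ∈ (Finset.univ : Finset (κ ⊕ κ)), (10 + 8 * Fintype.card κ + (16 * Fintype.card κ + 12) * C₀) * Mc) κ₁ κ₂ Λ (B6.c1 d δ₀ β) * α₁ *
            (B₀ * Λρ ^ 2 * B6.c1 d ρ α' *
            (1 - kappa385 B₀ (cV385 (Fintype.card κ) α₁ C₀ Mc
              + ∑ _k ∈ (Finset.univ : Finset (κ ⊕ κ)), (10 + 8 * Fintype.card κ + (16 * Fintype.card κ + 12) * C₀) * Mc) κ₁ κ₂ Λ (B6.c1 d δ₀ β) * α₁ * B6.c1 d ρ α')⁻¹) * Λρ * B6.c1 d ρ α') *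
          g.len (blk p₀.1.2) * Real.exp (-(ρ₃ * g.dist (blk p₀.1.2) y')) * M) := hn
    _ = (∑ i, ‖b i‖) * M₂ *
          (1 + kappa385 1 (cV385 (Fintype.card κ) α₁ C₀ Mc
              + ∑ _k ∈ (Finset.univ : Finset (κ ⊕ κ)), (10 + 8 * Fintype.card κ + (16 * Fintype.card κ + 12) * C₀) * Mc) κ₁ κ₂ Λ (B6.c1 d δ₀ β) * α₁ *
            (B₀ * Λρ ^ 2 * B6.c1 d ρ α' *
            (1 - kappa385 B₀ (cV385 (Fintype.card κ) α₁ C₀ Mc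
              + ∑ _k ∈ (Finset.univ : Finset (κ ⊕ κ)), (10 + 8 * Fintype.card κ + (16 * Fintype.card κ + 12) * C₀) * Mc) κ₁ κ₂ Λ (B6.c1 d δ₀ β) * α₁ * B6.c1 d ρ α')⁻¹) * Λρ * B6.c1 d ρ α') *
          Bh * g.len (blk p₀.1.2) ^ (1 - γ) * cζ * Real.exp (-(ρ₃ * g.dist (blk p₀.1.2) y')) * M := by
        have e : (∑ i, ‖b i‖) * (B₀' * (1 + kappa385 1 (cV385 (Fintype.card κ) α₁ C₀ Mc
              + ∑ _k ∈ (Finset.univ : Finset (κ ⊕ κ)), (10 + 8 * Fintype.card κ + (16 * Fintype.card κ + 12) * C₀) * Mc) κ₁ κ₂ Λ (B6.c1 d δ₀ β) * α₁ *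
            (B₀ * Λρ ^ 2 * B6.c1 d ρ α' *
            (1 - kappa385 B₀ (cV385 (Fintype.card κ) α₁ C₀ Mc
              + ∑ _k ∈ (Finset.univ : Finset (κ ⊕ κ)), (10 + 8 * Fintype.card κ + (16 * Fintype.card κ + 12) * C₀) * Mc) κ₁ κ₂ Λ (B6.c1 d δ₀ β) * α₁ * B6.c1 d ρ α')⁻¹) * Λρ * B6.c1 d ρ α') *
            g.len (blk p₀.1.2) * Real.exp (-(ρ₃ * g.dist (blk p₀.1.2) y')) * M) =
            (∑ i, ‖b i‖) * (1 + kappa385 1 (cV385 (Fintype.card κ) α₁ C₀ Mc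
              + ∑ _k ∈ (Finset.univ : Finset (κ ⊕ κ)), (10 + 8 * Fintype.card κ + (16 * Fintype.card κ + 12) * C₀) * Mc) κ₁ κ₂ Λ (B6.c1 d δ₀ β) * α₁ *
            (B₀ * Λρ ^ 2 * B6.c1 d ρ α' *
            (1 - kappa385 B₀ (cV385 (Fintype.card κ) α₁ C₀ Mc
              + ∑ _k ∈ (Finset.univ : Finset (κ ⊕ κ)), (10 + 8 * Fintype.card κ + (16 * Fintype.card κ + 12) * C₀) * Mc) κ₁ κ₂ Λ (B6.c1 d δ₀ β) * α₁ * B6.c1 d ρ α')⁻¹) * Λρ * B6.c1 d ρ α') *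
            (B₀' * g.len (blk p₀.1.2)) * Real.exp (-(ρ₃ * g.dist (blk p₀.1.2) y')) * M := by ring
        rw [e, hB1]; ring

end Concrete

end Literature.MathematicalPhysics.QuantumFieldTheory.Balaban1983to89.B9Thm34HolderRightG
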